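import Summits.QuantumFields.YangMills.Theorems.UnitScaleTiltProp7SymCentreAbelian
import Summits.QuantumFields.YangMills.Theorems.UnitScaleTiltProp7SymCentreFluxSupplierT3
import Summits.QuantumFields.YangMills.Theorems.UnitScaleTiltProp7SymCentreRowOfSupplier
import HarnessLib

/-!
# Route `UnitScaleTilt`, crux K1 child «MinimiserStabilityRegPr» (stmt-QuantumFields-19200), stub `stub_existenceMinimalOrbit` (EX), line «SYM-CENTRE»
# (★★OWNER RULING g28-№7 cure (ii-a)) — **THE (R4) ASSEMBLY CLOSED: the displayed flux brick `hFlux` of ✓`exists_symCentre_of_fluxCombine` INHABITED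
# by ★w5-20520 g8's T³ flux supplier ✓`LinearLiftFlux.exists_flux_supplier_T3`, hence `hSymCentre`'s ∃-body UNCONDITIONALLY for every small-plaquette
# coarse field with a regular fibre point, and the σ₃-diagonal supplier for every L**

Cell `ym3-torus`, width seat `ym3-torus-px6` (gen 3).  THEOREMS ONLY (0 `def`, 0 `sorry`).  `--supports stmt-QuantumFields-19200 --as helper`, count-neutral
(★★OWNER ACK 86: the row of record `hSymCentre` is discharged by DENSITY ✓p677825; this is the banked second, constructive inhabitation).  YM₃ on T³ is a
ladder rung (R3), not the Clay problem; nothing here claims the stub, the crux, d = 4 or the mass gap.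

* §1 `hFlux_T3` — the flux brick at `cF := (10⁸·L²)⁻¹`, `CF := 4·10⁶`: the two numeric windows of ✓`exists_flux_supplier_T3` (`6φ₀ < 2π` and the loop-sum
  window `3·(π∕2)·((5L)²∕4)·(2·54³+1)·φ₀ < 1`) follow from `φ₀ ≤ (10⁸·L²)⁻¹`.
* §2 ★★★`diagonalLift_abelian` — for EVERY σ₃-diagonal `V′` with `PlaqSmall ε₁ V′`, `(π∕2)ε₁ ≤ (10⁸L²)⁻¹`: a σ₃-diagonal `U₁ ∈ fibre V′` with
  `RegPr (4·10⁶·(π∕2)ε₁) U₁`; ★★★`exists_symCentre_abelian` — `hSymCentre`'s ∃-body (fibre point, `RegPr`, `CloseAvg`, `hLift`) for EVERY `V` with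
  `PlaqSmall ε₁ V` and a regular fibre point, under explicit numeric windows only.
* §3 `hSupL_T3` — the per-`L` σ₃-diagonal supplier in the letters of ★px20 g3's ROW-KNIT door (✓p678499), `aF := (2·10⁸·L²)⁻¹`, `CF := 2·10⁶·π`;
  ★★★`hSymCentreRow_T3` — the displayed row `hSymCentre` of the EX display of record (as the EX knit instantiates it, `Lift :=` the `hLift` text) as a
  THEOREM: ✓`hSymCentreRow_of_diagonalLiftSupplierL_record hSupL_T3`.
HONEST SCOPE.  Composition of ✓`exists_symCentre_of_fluxCombine` ∕ ✓`diagonalLift_of_fluxCombine` (px6, ✓p678309) with ✓`exists_flux_supplier_T3` (w5-20520 g8)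
and ✓`hSymCentreRow_of_diagonalLiftSupplierL_record` (px20 g3, ✓p678499) plus interval arithmetic; no stub ∕ crux statement is advanced (★★OWNER ACK 86: EX's
row of record is discharged by DENSITY ✓p677825 — this file is the banked constructive inhabitation).

References: T. Bałaban, CMP 102 (1985) 277–309 [Balaban1985Variational] ((2)–(7) p.278, (13)–(14) p.280); CMP 98 (1985) 17–51 [Balaban1985Averaging] ((9), (11)
p.19, (19)–(24) p.21); CMP 109 (1987) 249–301 [Balaban1987RG1] ((0.4), (0.11) p.253); CMP 99 (1985) 389–434 [Balaban1985BackgroundPropagators] ((3.21) p.394).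
-/

set_option autoImplicit false

noncomputable section

open scoped BigOperators Matrix.Norms.L2Operator Matrix

namespace Summit.QuantumFields.YangMills.Theorems.Prop7NestedMeanParallelLiftDiagGauge

open Literature.MathematicalPhysics.QuantumFieldTheory.Balaban1983to89
open T4Continuum
open B10Eq27TorusAxialLog (unitsField toUField)
open B15DeterminingSets (embIter)
open B9AdOrthogonal (σ₃)
open BlockAveraging (Idx)
open Summit.QuantumFields.YangMills.Theorems.Prop8Chart (emlIterU)
open Literature.MathematicalPhysics.QuantumFieldTheory.Balaban1983to89.T3ContinuumYM3Torus
open T3UnitLawDensityEML (ℰp)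
open T3ConstrainedMinimiser (fibre)
open T3PrintedRegularMinimiser (RegPr)
open T3PrintedRegularOrbits (sites_eq)
open T3SectALandauChart (bgUnits CloseAvg)
open Summit.QuantumFields.Balaban3D.Carriers (suGroupModel)
open Summit.QuantumFields.YangMills.Theorems.AbelianEML (gexpAt linAvgIter loopSum curlAt)
open Summit.QuantumFields.YangMills.Theorems.Prop7SymCentreAbelianDict (I_smul_sigma3_mem_lie)
open Summit.QuantumFields.YangMills.Theorems.LinearLiftFlux (exists_flux_supplier_T3)

section T3

variable (F : T3Family) {n K : ℕ}

/-! ## §1 The flux brick, inhabited -/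

/-- The two numeric windows of the T³ flux supplier follow from `φ₀ ≤ (10⁸·L²)⁻¹`: `6φ₀ < 2π` and the loop-sum window
`3·(π∕2)·(((d+2)L)²∕4)·(2·54³+1)·φ₀ < 1` at `d = 3`. [cite: Balaban1985Averaging, (19)-(24) p.21] -/
theorem fluxWindows_of_le (K : ℕ) {φ₀ : ℝ} (hφ0 : 0 < φ₀) (hφc : φ₀ ≤ ((10 : ℝ) ^ 8 * (F.L : ℝ) ^ 2)⁻¹) :
    6 * φ₀ < 2 * Real.pi ∧
      3 * (Real.pi / 2 * ((((((F.P K).d + 2) * (F.P K).L : ℕ) : ℝ) ^ 2 / 4) * ((2 * 54 ^ 3 + 1) * φ₀))) < 1 := by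
  have hL1 : (1 : ℝ) ≤ (F.L : ℝ) := by exact_mod_cast F.hL.2.le
  have hL2 : (1 : ℝ) ≤ (F.L : ℝ) ^ 2 := by nlinarith
  have hpos : (0 : ℝ) < (10 : ℝ) ^ 8 * (F.L : ℝ) ^ 2 := by positivity
  have h1 : φ₀ * ((10 : ℝ) ^ 8 * (F.L : ℝ) ^ 2) ≤ 1 := by
    rw [← le_div_iff₀ hpos, one_div]; exact hφc
  have hX : (F.L : ℝ) ^ 2 * φ₀ ≤ 1 / 10 ^ 8 := by
    rw [le_div_iff₀ (by norm_num)]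
    calc (F.L : ℝ) ^ 2 * φ₀ * 10 ^ 8 = φ₀ * ((10 : ℝ) ^ 8 * (F.L : ℝ) ^ 2) := by ring
      _ ≤ 1 := h1
  have hφs : φ₀ ≤ 1 / 10 ^ 8 := by
    calc φ₀ = 1 * φ₀ := (one_mul φ₀).symm
      _ ≤ (F.L : ℝ) ^ 2 * φ₀ := mul_le_mul_of_nonneg_right hL2 hφ0.le
      _ ≤ 1 / 10 ^ 8 := hX
  have hcast : ((((F.P K).d + 2) * (F.P K).L : ℕ) : ℝ) = 5 * (F.L : ℝ) := by
    show (((3 + 2) * F.L : ℕ) : ℝ) = 5 * (F.L : ℝ)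
    push_cast; ring
  refine ⟨by linarith [Real.pi_gt_three], ?_⟩
  rw [hcast]
  calc 3 * (Real.pi / 2 * ((5 * (F.L : ℝ)) ^ 2 / 4 * ((2 * 54 ^ 3 + 1) * φ₀)))
      = (3 * 25 * (2 * 54 ^ 3 + 1) / 8) * Real.pi * ((F.L : ℝ) ^ 2 * φ₀) := by ring
    _ ≤ (3 * 25 * (2 * 54 ^ 3 + 1) / 8) * 4 * (1 / 10 ^ 8) := by gcongr; exact Real.pi_le_four
    _ < 1 := by norm_num

/-- **The flux brick `hFlux` of ✓`exists_symCentre_of_fluxCombine`, INHABITED at `cF := (10⁸·L²)⁻¹`, `CF := 4·10⁶`** — ★w5-20520 g8's T³ flux supplier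
✓`exists_flux_supplier_T3` (ZCLASS ∘ FLUX-LIFT ∘ smooth lift ∘ loop-sum rows ∘ mod-ℤ `RegPr`) with its two windows discharged by `fluxWindows_of_le`.
[cite: Balaban1985Averaging, (9), (11) p.19, (19)-(24) p.21] [cite: Balaban1985Variational, (13)-(14) p.280] -/
theorem hFlux_T3 (n K : ℕ) :
    ∀ (Θ : PBond (F.P K) (K - n) → ℝ) (m : Site (F.P K) (K - n) → Fin (F.P K).d → Fin (F.P K).d → ℤ) (φ₀ : ℝ),
      0 < φ₀ → φ₀ ≤ ((10 : ℝ) ^ 8 * (F.L : ℝ) ^ 2)⁻¹ → (∀ x μ, m x μ μ = 0) →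
      (∀ (x : Site (F.P K) (K - n)) (μ ν : Fin (F.P K).d), μ ≠ ν → |curlAt Θ x μ ν - 2 * Real.pi * m x μ ν| ≤ φ₀) →
      ∃ (s : PBond (F.P K) (K - n) → ℤ) (a : PBond (F.P K) 0 → ℝ),
        (linAvgIter (K - n) a = fun e => Θ e - 2 * Real.pi * s e) ∧
        (∀ s', s' < K - n → ∀ (c : PBond (F.P K) (s' + 1)) (i : Idx (F.P K)), 3 * |loopSum (linAvgIter s' a) c i| < 1) ∧
        RegPr F n K (4000000 * φ₀) (gexpAt (suGroupModel 2) I_smul_sigma3_mem_lie a) := by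
  intro Θ m φ₀ hφ0 hφc hmdiag hm
  obtain ⟨hφ, hwin⟩ := fluxWindows_of_le F K hφ0 hφc
  exact exists_flux_supplier_T3 F n K Θ m hφ0 hφ hm hmdiag hwin

/-! ## §2 The σ₃-diagonal supplier and `hSymCentre`'s ∃-body, unconditionally -/

/-- ★★★ **THE σ₃-DIAGONAL SUPPLIER, FOR EVERY `L`.**  For every σ₃-diagonal coarse field `V′` with `PlaqSmall ε₁ V′` and `(π∕2)ε₁ ≤ (10⁸·L²)⁻¹`: a
σ₃-diagonal fine field `U₁ ∈ fibre V′` with `RegPr (4·10⁶·(π∕2)ε₁) U₁` — ✓`diagonalLift_of_fluxCombine` with `hFlux := hFlux_T3`.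
[cite: Balaban1985Variational, (2)-(7) p.278, (13)-(14) p.280] [cite: Balaban1985Averaging, (19)-(24) p.21] -/
theorem diagonalLift_abelian (h : n ≤ K) {ε₁ : ℝ} (hε₁ : 0 < ε₁) (hε : Real.pi / 2 * ε₁ ≤ ((10 : ℝ) ^ 8 * (F.L : ℝ) ^ 2)⁻¹)
    (V' : GaugeField (F.P n) 0 (Matrix.specialUnitaryGroup (Fin 2) ℂ))
    (hdiag : ∀ e : PBond (F.P n) 0, Commute ((V' e : Matrix.specialUnitaryGroup (Fin 2) ℂ) : Matrix (Fin 2) (Fin 2) ℂ) σ₃) (hV' : PlaqSmall ε₁ V') :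
    ∃ U₁ : GaugeField (F.P K) 0 (Matrix.specialUnitaryGroup (Fin 2) ℂ),
      U₁ ∈ fibre F ℰp n K h V' ∧ RegPr F n K (4000000 * (Real.pi / 2 * ε₁)) U₁ ∧
      ∀ b : PBond (F.P K) 0, Commute ((U₁ b : Matrix.specialUnitaryGroup (Fin 2) ℂ) : Matrix (Fin 2) (Fin 2) ℂ) σ₃ :=
  diagonalLift_of_fluxCombine F h hε₁ hε (hFlux_T3 F n K) V' hdiag hV'

/-- ★★★ **`hSymCentre`'s ∃-BODY, UNCONDITIONALLY (numeric windows only).**  For EVERY coarse field `V` with `PlaqSmall ε₁ V` (`ε₁ ≤ 2`,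
`(π∕2)ε₁ ≤ (10⁸L²)⁻¹`), every `U₀ ∈ fibre V` with `RegPr a U₀` (`0 < a ≤ a′ := 4·10⁶·(π∕2)ε₁`, `10⁷L³a ≤ 1`, `10⁷L³a′ ≤ 1`) and every `b > 0`: some
`U₁ ∈ fibre V` with `RegPr a′ U₁`, `CloseAvg b V U₁` AND the parallel-section lifting property `hLift U₁` — ✓`exists_symCentre_of_fluxCombine` with
`hFlux := hFlux_T3` (irreducible ∕ re-gauge ∕ central-in-disguise ∕ flux-free ∕ flux sector, all by name).
[cite: Balaban1985Variational, (2)-(7) p.278, (13)-(14) p.280] [cite: Balaban1985Averaging, (9), (11) p.19, (19)-(24) p.21] [cite: Balaban1987RG1, (0.4), (0.11) p.253] -/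
theorem exists_symCentre_abelian (h : n ≤ K) {ε₁ a b : ℝ} (hε₁ : 0 < ε₁) (hε2 : ε₁ ≤ 2) (hε : Real.pi / 2 * ε₁ ≤ ((10 : ℝ) ^ 8 * (F.L : ℝ) ^ 2)⁻¹)
    (ha : 0 < a) (haW : 10 ^ 7 * (F.L : ℝ) ^ 3 * a ≤ 1) (haa' : a ≤ 4000000 * (Real.pi / 2 * ε₁))
    (ha'W : 10 ^ 7 * (F.L : ℝ) ^ 3 * (4000000 * (Real.pi / 2 * ε₁)) ≤ 1) (hb : 0 < b)
    {V : GaugeField (F.P n) 0 (Matrix.specialUnitaryGroup (Fin 2) ℂ)} {U₀ : GaugeField (F.P K) 0 (Matrix.specialUnitaryGroup (Fin 2) ℂ)}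
    (hV : PlaqSmall ε₁ V) (hfib : U₀ ∈ fibre F ℰp n K h V) (hreg : RegPr F n K a U₀) :
    ∃ U₁ : GaugeField (F.P K) 0 (Matrix.specialUnitaryGroup (Fin 2) ℂ),
      U₁ ∈ fibre F ℰp n K h V ∧ RegPr F n K (4000000 * (Real.pi / 2 * ε₁)) U₁ ∧ CloseAvg F n K h b V U₁ ∧
      ∀ cf : Site (F.P K) (K - n) → Matrix (Fin 2) (Fin 2) ℂ,
        (∀ e : PBond (F.P K) (K - n), cf e.src = ((emlIterU (K - n) (bgUnits F K U₁) e : (Matrix (Fin 2) (Fin 2) ℂ)ˣ) : Matrix (Fin 2) (Fin 2) ℂ) * cf e.tgt *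
          (((emlIterU (K - n) (bgUnits F K U₁) e)⁻¹ : (Matrix (Fin 2) (Fin 2) ℂ)ˣ) : Matrix (Fin 2) (Fin 2) ℂ)) →
        ∃ l₀ : Site (F.P K) 0 → Matrix (Fin 2) (Fin 2) ℂ,
          (∀ b' : PBond (F.P K) 0, l₀ b'.src = ((bgUnits F K U₁ b' : (Matrix (Fin 2) (Fin 2) ℂ)ˣ) : Matrix (Fin 2) (Fin 2) ℂ) * l₀ b'.tgt * (((bgUnits F K U₁ b')⁻¹ : (Matrix (Fin 2) (Fin 2) ℂ)ˣ) : Matrix (Fin 2) (Fin 2) ℂ)) ∧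
          ∀ y : Site (F.P K) (K - n), l₀ (embIter (K - n) y) = cf y :=
  exists_symCentre_of_fluxCombine F h hε₁ hε2 hε ha haW haa' ha'W hb (hFlux_T3 F n K) hV hfib hreg

/-! ## §3 The per-`L` supplier and the displayed row `hSymCentre` as a theorem -/

/-- The per-`L` σ₃-diagonal supplier in the letters of ★px20 g3's ROW-KNIT door (✓`hSymCentreRow_of_diagonalLiftSupplierL_record`): `aF := (2·10⁸·L²)⁻¹`,
`CF := 2·10⁶·π` (`(π∕2)·ε₁ ≤ (π∕4)·(10⁸L²)⁻¹ ≤ (10⁸L²)⁻¹` and `4·10⁶·((π∕2)ε₁) = (2·10⁶π)·ε₁`); the parallel-constant antecedent is not used.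
[cite: Balaban1985Variational, (2)-(7) p.278, (13)-(14) p.280] [cite: Balaban1985Averaging, (19)-(24) p.21] -/
theorem hSupL_T3 : ∀ (L : ℕ), 1 < L → ∃ aF CF : ℝ, 0 < aF ∧ 0 < CF ∧ ∀ (F : T3Family), F.L = L → ∀ (n K : ℕ) (h : n ≤ K) (ε₁ : ℝ), 0 < ε₁ → ε₁ ≤ aF →
      ∀ V' : GaugeField (F.P n) 0 (Matrix.specialUnitaryGroup (Fin 2) ℂ),
        (∀ e : PBond (F.P n) 0, Commute ((V' e : Matrix.specialUnitaryGroup (Fin 2) ℂ) : Matrix (Fin 2) (Fin 2) ℂ) σ₃) →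
        (∀ c : Site (F.P n) 0 → Matrix (Fin 2) (Fin 2) ℂ,
          (∀ e : PBond (F.P n) 0, c e.src = ((unitsField (toUField V') e : (Matrix (Fin 2) (Fin 2) ℂ)ˣ) : Matrix (Fin 2) (Fin 2) ℂ) * c e.tgt *
            (((unitsField (toUField V') e)⁻¹ : (Matrix (Fin 2) (Fin 2) ℂ)ˣ) : Matrix (Fin 2) (Fin 2) ℂ)) →
          ∃ c₀ : Matrix (Fin 2) (Fin 2) ℂ, (∀ y, c y = c₀) ∧ Commute c₀ σ₃) →
        PlaqSmall ε₁ V' →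
        ∃ U₁ : GaugeField (F.P K) 0 (Matrix.specialUnitaryGroup (Fin 2) ℂ), U₁ ∈ fibre F ℰp n K h V' ∧ RegPr F n K (CF * ε₁) U₁ ∧
          ∀ b' : PBond (F.P K) 0, Commute ((U₁ b' : Matrix.specialUnitaryGroup (Fin 2) ℂ) : Matrix (Fin 2) (Fin 2) ℂ) σ₃ := by
  intro L hL
  have hL1 : (1 : ℝ) ≤ (L : ℝ) := by exact_mod_cast hL.le
  have hpos : (0 : ℝ) < (10 : ℝ) ^ 8 * (L : ℝ) ^ 2 := by positivity
  refine ⟨(2 * ((10 : ℝ) ^ 8 * (L : ℝ) ^ 2))⁻¹, 2000000 * Real.pi, by positivity, by positivity, ?_⟩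
  intro F hFL n K h ε₁ hε₁ hε₁a V' hdiag _ hV'
  have hFL' : (F.L : ℝ) = (L : ℝ) := by exact_mod_cast hFL
  have hε : Real.pi / 2 * ε₁ ≤ ((10 : ℝ) ^ 8 * (F.L : ℝ) ^ 2)⁻¹ := by
    rw [hFL']
    calc Real.pi / 2 * ε₁ ≤ 4 / 2 * (2 * ((10 : ℝ) ^ 8 * (L : ℝ) ^ 2))⁻¹ := by gcongr; exact Real.pi_le_four
      _ = ((10 : ℝ) ^ 8 * (L : ℝ) ^ 2)⁻¹ := by rw [mul_inv]; ring
  obtain ⟨U₁, hU₁, hregU, hdiagU⟩ := diagonalLift_abelian F h hε₁ hε V' hdiag hV'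
  have hr : (4000000 : ℝ) * (Real.pi / 2 * ε₁) = 2000000 * Real.pi * ε₁ := by ring
  exact ⟨U₁, hU₁, hr ▸ hregU, hdiagU⟩

/-- ★★★ **THE DISPLAYED ROW `hSymCentre` OF THE EX DISPLAY OF RECORD, AS A THEOREM** (as the EX knit instantiates it: `Lift :=` the `hLift` text of record;
`aS`, `CS` from ★px20 g3's windows): ✓`hSymCentreRow_of_diagonalLiftSupplierL_record` (ROW-KNIT door, ✓p678499) applied to `hSupL_T3`.  The banked, constructive
inhabitation of the row (the row of record is discharged by DENSITY ✓p677825, ★★OWNER ACK 86); count-neutral.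
[cite: Balaban1985Variational, Thm 1 p.279, (2)-(7) p.278, (13)-(14) p.280] [cite: Balaban1985BackgroundPropagators, (3.21) p.394] [cite: Balaban1987RG1, (0.4) p.253] -/
theorem hSymCentreRow_T3 :
    ∀ (L : ℕ), 1 < L → ∃ aS CS : ℝ, 0 < aS ∧ (L : ℝ) ^ 3 * (3 * (L : ℝ)) ≤ CS ∧ ∀ (i : T3Thm1Carrier.Idx L) (ε₁ : ℝ), 0 < ε₁ → ε₁ ≤ aS →
        ∀ (V : GaugeField (i.1.1.P i.1.2.1) 0 (Matrix.specialUnitaryGroup (Fin 2) ℂ)) (U₀ : GaugeField (i.1.1.P i.1.2.2) 0 (Matrix.specialUnitaryGroup (Fin 2) ℂ)),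
          PlaqSmall ε₁ V → RegPr i.1.1 i.1.2.1 i.1.2.2 ((L : ℝ) ^ 3 * (3 * (L : ℝ)) * ε₁) U₀ → U₀ ∈ fibre i.1.1 ℰp i.1.2.1 i.1.2.2 i.2.2.le V →
          ∃ U₁ : GaugeField (i.1.1.P i.1.2.2) 0 (Matrix.specialUnitaryGroup (Fin 2) ℂ),
            U₁ ∈ fibre i.1.1 ℰp i.1.2.1 i.1.2.2 i.2.2.le V ∧ RegPr i.1.1 i.1.2.1 i.1.2.2 (CS * ε₁) U₁ ∧
            ∀ cf : Site (i.1.1.P i.1.2.2) (i.1.2.2 - i.1.2.1) → Matrix (Fin 2) (Fin 2) ℂ,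
              (∀ e : PBond (i.1.1.P i.1.2.2) (i.1.2.2 - i.1.2.1), cf e.src =
                  ((emlIterU (i.1.2.2 - i.1.2.1) (bgUnits i.1.1 i.1.2.2 U₁) e : (Matrix (Fin 2) (Fin 2) ℂ)ˣ) : Matrix (Fin 2) (Fin 2) ℂ) * cf e.tgt *
                  (((emlIterU (i.1.2.2 - i.1.2.1) (bgUnits i.1.1 i.1.2.2 U₁) e)⁻¹ : (Matrix (Fin 2) (Fin 2) ℂ)ˣ) : Matrix (Fin 2) (Fin 2) ℂ)) →
              ∃ l₀ : Site (i.1.1.P i.1.2.2) 0 → Matrix (Fin 2) (Fin 2) ℂ,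
                (∀ b' : PBond (i.1.1.P i.1.2.2) 0, l₀ b'.src =
                  ((bgUnits i.1.1 i.1.2.2 U₁ b' : (Matrix (Fin 2) (Fin 2) ℂ)ˣ) : Matrix (Fin 2) (Fin 2) ℂ) * l₀ b'.tgt *
                  (((bgUnits i.1.1 i.1.2.2 U₁ b')⁻¹ : (Matrix (Fin 2) (Fin 2) ℂ)ˣ) : Matrix (Fin 2) (Fin 2) ℂ)) ∧
                ∀ y : Site (i.1.1.P i.1.2.2) (i.1.2.2 - i.1.2.1), l₀ (embIter (i.1.2.2 - i.1.2.1) y) = cf y :=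
  hSymCentreRow_of_diagonalLiftSupplierL_record hSupL_T3

end T3

end Summit.QuantumFields.YangMills.Theorems.Prop7NestedMeanParallelLiftDiagGauge

end
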